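import Literature.NumberTheory.LFunctions.WeilThreePrimeSliver
import HarnessLib

/-!
# RiemannHypothesis / GroundBarta — rung 4 (`EvenWinsBeyondArch`, stmt-RiemannHypothesis-18807 / 18085):
# the three-prime sliver charges only the EDGE mass

Helper file (`--supports stmt-RiemannHypothesis-18085`), RH-free, no definitions, no named facts.  Prover A (gen 4 of
unit `sr-gb-rung-a`).

Refinement of `Literature/…/WeilThreePrimeSliver.lean`: for a test function `g` supported in `[-c, c]` and a shift `x > c`
the autocorrelation `k(x) = ∫ g(u) conj g(u − x) du` lives on `u ∈ [x − c, c]`, `u − x ∈ [−c, c − x]`, so that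
`2|g(u)||g(u−x)| ≤ |g(u)|² + |g(u−x)|²` integrates to

  `|k(x)| ≤ ½ ∫_{|u| ≥ x − c} |g(u)|² du`       (`dt_norm_weilConv_weilReflect_le_half_edge`)

— only the mass of `g` in the two EDGE intervals `|u| ≥ x − c` enters (the library lemma bounds it by `½‖g‖₂²`).  Hence on the
`{2,3,4}`-window (`c ≤ (log 5)/2`):

  `E₂₃(g) − (log 2)/2 · ∫_{|u| ≥ y₁} |g|² ≤ Re Q(g)`   for any `y₁ ≤ log 4 − c`
  (`dt_weilTwoPrimeQuadratic_sub_edge_le_weilQuadratic_re`),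

i.e. a two-prime certificate at level `β₂₃` certifies the true form with the POINTWISE level
`β₂₃ − (log 2)/2 · 𝟙_{|u| ≥ y₁}` instead of the scalar `β₂₃ − (log 2)/2` — the input of the weighted deflated Temple
criterion (`…DeflationWeightedRitz`).  At `c = 0.77` the edge set `|u| ≥ 0.616` carries 3–10 % of the certified residual mass.
-/

set_option linter.dupNamespace false

noncomputable section

open Complex Filter Set MeasureTheory
open scoped Real Topology ComplexConjugate

namespace Summit.RiemannHypothesis.RiemannHypothesis.Theorems.EvenWinsBeyondArch

open Literature.NumberTheory.LFunctions

variable {g : ℝ → ℂ}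

/-- **Sliver bound, edge form.** For a test function `g` supported in `[-c, c]` and a shift `x > c`:
`|k(x)| ≤ ½ ∫_{|u| ≥ x − c} |g(u)|² du`. [folklore] -/
theorem dt_norm_weilConv_weilReflect_le_half_edge (hg : IsWeilTest g) {c x : ℝ} (hsupp : tsupport g ⊆ Icc (-c) c)
    (hx : c < x) :
    ‖weilConv g (weilReflect g) x‖ ≤ (∫ u : ℝ, {u : ℝ | x - c ≤ |u|}.indicator (fun u ↦ ‖g u‖ ^ 2) u) / 2 := by
  have h2 : Integrable fun u : ℝ ↦ ‖g u‖ ^ 2 := hg.integrable_norm_sq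
  set φ : ℝ → ℝ := (Ici (x - c)).indicator fun u ↦ ‖g u‖ ^ 2 with hφ
  set ψ : ℝ → ℝ := (Iic (c - x)).indicator fun u ↦ ‖g u‖ ^ 2 with hψ
  set χ : ℝ → ℝ := {u : ℝ | x - c ≤ |u|}.indicator fun u ↦ ‖g u‖ ^ 2 with hχ
  have hφi : Integrable φ := h2.indicator measurableSet_Ici
  have hψi : Integrable ψ := h2.indicator measurableSet_Iic
  have hχi : Integrable χ := h2.indicator (measurableSet_le measurable_const continuous_abs.measurable)
  have hψi' : Integrable fun u : ℝ ↦ ψ (u - x) := hψi.comp_sub_right x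
  have hφ0 : ∀ u, 0 ≤ φ u := fun u ↦ Set.indicator_nonneg (fun _ _ ↦ by positivity) u
  have hψ0 : ∀ u, 0 ≤ ψ u := fun u ↦ Set.indicator_nonneg (fun _ _ ↦ by positivity) u
  have hχ0 : ∀ u, 0 ≤ χ u := fun u ↦ Set.indicator_nonneg (fun _ _ ↦ by positivity) u
  have hzero : ∀ u, g u ≠ 0 → u ∈ Icc (-c) c := fun u hu ↦ hsupp (subset_tsupport _ hu)
  -- pointwise: 2 |g(u)| |g(u − x)| ≤ φ(u) + ψ(u − x)
  have hpt : ∀ u, ‖g u * weilReflect g (x - u)‖ ≤ (φ u + ψ (u - x)) / 2 := by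
    intro u
    simp only [weilReflect, norm_mul, Complex.norm_conj, neg_sub]
    by_cases hgu : g u = 0
    · rw [hgu, norm_zero, zero_mul]; linarith [hφ0 u, hψ0 (u - x)]
    by_cases hgv : g (u - x) = 0
    · rw [hgv, norm_zero, mul_zero]; linarith [hφ0 u, hψ0 (u - x)]
    have hu := hzero u hgu
    have hv := hzero (u - x) hgv
    have h1 : u ∈ Ici (x - c) := by simp only [mem_Ici]; linarith [hv.1]
    have h2' : u - x ∈ Iic (c - x) := by simp only [mem_Iic]; linarith [hu.2]
    rw [hφ, hψ, Set.indicator_of_mem h1, Set.indicator_of_mem h2']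
    linarith [two_mul_le_add_sq ‖g u‖ ‖g (u - x)‖]
  -- the two indicators are disjoint parts of the EDGE set: φ + ψ ≤ χ
  have hsum : ∀ u, φ u + ψ u ≤ χ u := by
    intro u
    by_cases h1 : u ∈ Ici (x - c)
    · have h2' : u ∉ Iic (c - x) := by
        simp only [mem_Ici, mem_Iic, not_le] at h1 ⊢; linarith
      have h3 : u ∈ {u : ℝ | x - c ≤ |u|} := by
        simp only [mem_Ici] at h1
        simp only [mem_setOf_eq]
        exact h1.trans (le_abs_self u)
      rw [hφ, hψ, hχ, Set.indicator_of_mem h1, Set.indicator_of_notMem h2', Set.indicator_of_mem h3]; linarith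
    · rw [hφ, Set.indicator_of_notMem h1, zero_add]
      by_cases h2' : u ∈ Iic (c - x)
      · have h3 : u ∈ {u : ℝ | x - c ≤ |u|} := by
          simp only [mem_Iic] at h2'
          simp only [mem_setOf_eq]
          have : x - c ≤ -u := by linarith
          exact this.trans (neg_le_abs u)
        rw [hψ, hχ, Set.indicator_of_mem h2', Set.indicator_of_mem h3]
      · rw [hψ, Set.indicator_of_notMem h2']; exact hχ0 u
  rw [weilConv_apply]
  calc ‖∫ u : ℝ, g u * weilReflect g (x - u)‖
      ≤ ∫ u : ℝ, ‖g u * weilReflect g (x - u)‖ := norm_integral_le_integral_norm _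
    _ ≤ ∫ u : ℝ, (φ u + ψ (u - x)) / 2 :=
        integral_mono_of_nonneg (Eventually.of_forall fun _ ↦ norm_nonneg _)
          ((hφi.add hψi').div_const 2) (Eventually.of_forall hpt)
    _ = ((∫ u : ℝ, φ u) + ∫ u : ℝ, ψ u) / 2 := by
        rw [integral_div, integral_add hφi hψi', integral_sub_right_eq_self ψ x]
    _ = (∫ u : ℝ, φ u + ψ u) / 2 := by rw [integral_add hφi hψi]
    _ ≤ (∫ u : ℝ, χ u) / 2 :=
        div_le_div_of_nonneg_right (integral_mono (hφi.add hψi) hχi hsum) (by norm_num)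

/-- Edge form for both shifts `±x`: `|k(x) + k(−x)| ≤ ∫_{|u| ≥ x − c} |g|²`. [folklore] -/
theorem dt_norm_weilConv_weilReflect_add_neg_le_edge (hg : IsWeilTest g) {c x : ℝ} (hsupp : tsupport g ⊆ Icc (-c) c)
    (hx : c < x) :
    ‖weilConv g (weilReflect g) x + weilConv g (weilReflect g) (-x)‖ ≤
      ∫ u : ℝ, {u : ℝ | x - c ≤ |u|}.indicator (fun u ↦ ‖g u‖ ^ 2) u := by
  have h := dt_norm_weilConv_weilReflect_le_half_edge hg hsupp hx
  have h' : ‖weilConv g (weilReflect g) (-x)‖ ≤ (∫ u : ℝ, {u : ℝ | x - c ≤ |u|}.indicator (fun u ↦ ‖g u‖ ^ 2) u) / 2 := by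
    rw [← conj_weilConv_weilReflect_neg, Complex.norm_conj] at h; exact h
  calc ‖weilConv g (weilReflect g) x + weilConv g (weilReflect g) (-x)‖
      ≤ ‖weilConv g (weilReflect g) x‖ + ‖weilConv g (weilReflect g) (-x)‖ := norm_add_le _ _
    _ ≤ _ := by linarith

/-- **The sliver charges only the edge mass**: for `tsupport g ⊆ [-c, c]`, `c < log 4`,
`|E₂₃₄(g) − E₂₃(g)| ≤ (log 2)/2 · ∫_{|u| ≥ log 4 − c} |g|²`. [folklore] -/
theorem dt_abs_weilThreePrimeQuadratic_sub_weilTwoPrimeQuadratic_le_edge (hg : IsWeilTest g) {c : ℝ}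
    (hsupp : tsupport g ⊆ Icc (-c) c) (hc : c < Real.log 4) :
    |weilThreePrimeQuadratic g - weilTwoPrimeQuadratic g| ≤
      Real.log 2 / 2 * ∫ u : ℝ, {u : ℝ | Real.log 4 - c ≤ |u|}.indicator (fun u ↦ ‖g u‖ ^ 2) u := by
  rw [weilThreePrimeQuadratic_sub_weilTwoPrimeQuadratic hg]
  have hk := dt_norm_weilConv_weilReflect_add_neg_le_edge hg hsupp hc
  have hre := Complex.abs_re_le_norm
    (weilConv g (weilReflect g) (Real.log 4) + weilConv g (weilReflect g) (-Real.log 4))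
  have hlog : 0 ≤ Real.log 2 / 2 := by positivity
  rw [abs_mul, abs_neg, abs_of_nonneg hlog]
  exact mul_le_mul_of_nonneg_left (hre.trans hk) hlog

/-- Monotonicity of the edge mass in the threshold: for `y₁ ≤ a`, `∫_{|u| ≥ a} |g|² ≤ ∫_{|u| ≥ y₁} |g|²`. [folklore] -/
theorem dt_edgeMass_mono (hg : IsWeilTest g) {y₁ a : ℝ} (h : y₁ ≤ a) :
    (∫ u : ℝ, {u : ℝ | a ≤ |u|}.indicator (fun u ↦ ‖g u‖ ^ 2) u) ≤
      ∫ u : ℝ, {u : ℝ | y₁ ≤ |u|}.indicator (fun u ↦ ‖g u‖ ^ 2) u := by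
  have h2 : Integrable fun u : ℝ ↦ ‖g u‖ ^ 2 := hg.integrable_norm_sq
  refine integral_mono (h2.indicator (measurableSet_le measurable_const continuous_abs.measurable)) (h2.indicator (measurableSet_le measurable_const continuous_abs.measurable)) fun u ↦ ?_
  exact Set.indicator_le_indicator_of_subset (fun u (hu : a ≤ |u|) ↦ h.trans hu) (fun _ ↦ by positivity) u

/-- **Pointwise-level form of the sliver on the `{2,3,4}`-window**: for `tsupport g ⊆ [-c, c]`, `c ≤ (log 5)/2` and any
threshold `y₁ ≤ log 4 − c`, `E₂₃(g) − (log 2)/2 · ∫_{|u| ≥ y₁} |g|² ≤ Re Q(g)`. [folklore] -/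
theorem dt_weilTwoPrimeQuadratic_sub_edge_le_weilQuadratic_re (hg : IsWeilTest g) {c : ℝ}
    (hsupp : tsupport g ⊆ Icc (-c) c) (hc : c ≤ Real.log 5 / 2) {y₁ : ℝ} (hy : y₁ ≤ Real.log 4 - c) :
    weilTwoPrimeQuadratic g - Real.log 2 / 2 * (∫ u : ℝ, {u : ℝ | y₁ ≤ |u|}.indicator (fun u ↦ ‖g u‖ ^ 2) u) ≤
      (weilQuadratic g).re := by
  have hsupp' : tsupport g ⊆ Icc (-(Real.log 5 / 2)) (Real.log 5 / 2) :=
    hsupp.trans (Icc_subset_Icc (by linarith) hc)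
  have h54 : Real.log 5 / 2 < Real.log 4 := by
    have h5 : Real.log 5 < Real.log 16 := Real.log_lt_log (by norm_num) (by norm_num)
    have h16 : Real.log 16 = 2 * Real.log 4 := by
      rw [show (16 : ℝ) = 4 ^ 2 by norm_num, Real.log_pow]; push_cast; ring
    linarith
  rw [weilQuadratic_re_eq_weilThreePrimeQuadratic hg hsupp']
  have h := dt_abs_weilThreePrimeQuadratic_sub_weilTwoPrimeQuadratic_le_edge hg hsupp (lt_of_le_of_lt hc h54)
  rw [abs_le] at h
  have hm := mul_le_mul_of_nonneg_left (dt_edgeMass_mono hg hy) (show 0 ≤ Real.log 2 / 2 by positivity)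
  linarith [h.1]

end Summit.RiemannHypothesis.RiemannHypothesis.Theorems.EvenWinsBeyondArch

end
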